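import Summits.BirchSwinnertonDyer.BirchSwinnertonDyer.Theorems.AlignedTransportAtTwoMainConjectureOfRankZeroBSDAtTwoHalfDescentLayerIndexGrowthFiniteTwist
import HarnessLib

/-!
# Route `AlignedTransportAtTwo`, crux C2 `MainConjectureOfRankZeroBSDAtTwo` (stmt-BirchSwinnertonDyer-22298):
# THE TWIST READING OF THE MINUS PART, II — THE MINUS PART IS A TWISTED SELMER GROUP ONE LAYER DOWN (`p = 2`): for any additive isomorphism
# `Ψ : H¹(K_{n+1}, E′[2^∞]) ≃ H¹(K_{n+1}, E[2^∞])` matching the Selmer groups and ANTI-commuting with `g = γ^{2ⁿ}` (the quadratic twist by `K_{n+1}/K_n`):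
# `Ψ(res Sel_{2^∞}(E′/K_n)) ≤ M_{n+1} := ker(N_{K_{n+1}/K_n} | Sel_{2^∞}(E/K_{n+1}))`, `2·M_{n+1} ≤ Ψ(res Sel_{2^∞}(E′/K_n))`; hence
# `#Sel_{2^∞}(E′/K_n) ∣ #M_{n+1}·#(ker res ∩ Sel(E′/K_n))`, `#M_{n+1} ∣ #Sel_{2^∞}(E′/K_n)·#M_{n+1}[2]`, the order form of `Sel(E/K_{n+1}) ≈ Sel(E/K_n) ⊕ Sel(E′/K_n)`,
# `2^{2ⁿμ} ∣ #Sel_{2^∞}(E′/K_n)·#M_{n+1}[2]·#ker g_{n+1}` on the seed cell, and THE DOOR ON THE TWIST `0 < #Sel_{2^∞}(E′/K_n)·#M_{n+1}[2]·#ker g_{n+1} < 2^{2ⁿ} ⟹ μ = 0`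

HONEST FRAMING (cell `bsd-f1-sign2`, WIDTH-5 attached prover seat `bsd-line-att-p5` gen 58 on line `birth` of the lead `bsd-line-att-p2`;
`--supports` stmt-BirchSwinnertonDyer-22298, closes nothing; BSD is NOT proved by any of this; the crux C2, its verdict «blocked-on
`Rank1Residual.GreenbergMuConjectureIrreducible`» and every registered stub (P / T / Kμ / LimDoor / MuIneqʳ / PFμ⁺) are untouched). THEOREMS ONLY — no `def`,
no instance, no named fact, no `sorry`. Route-independent (any number field `K`, any `ℤ₂`-extension `κ` with topological generator `γ`, any layer `n`, any
Pontryagin-dual datum, any rank). Sequel of `…GrowthFiniteTwist` (the plus part: `res(Sel_n) ≤ Sel⁺_{n+1}`, `2·Sel⁺_{n+1} ≤ res(Sel_n)`, `#Sel_{n+1} = #Sel⁺·#I`)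
and of gen 57's `…GrowthFiniteTwo` / `…GrowthFiniteCell` (`2M ⊆ I ⊆ M`, `#I ∣ #M ∣ #I·#M[2]`, the norm-kernel door `0 < #M_{n+1}·#ker g_{n+1} < 2^{2ⁿ} ⟹ μ = 0`,
`2^{2ⁿμ} ∣ #I_{n+1}·#ker g_{n+1}` on the cell). Lineage glue on gen 57's successor (i), second half: the MINUS part.

THE TWISTING DATUM is kept ABSTRACT here: a second curve `W′/K` and `Ψ : H¹(Gal(K̄/K_{n+1}), W′[2^∞]) ≃+ H¹(Gal(K̄/K_{n+1}), W[2^∞])` with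
(hΨsel) `x ∈ Sel_{2^∞}(W′/K_{n+1}) ⟺ Ψ x ∈ Sel_{2^∞}(W/K_{n+1})` and (hΨg) `Ψ ∘ conj′_g = −conj_g ∘ Ψ`, `g = γ^{2ⁿ}`. The companion `…GrowthFiniteTwistQuadratic`
DISCHARGES it at the first layer (`n = 0`, `K_1 = K(√d)`) for the tree's quadratic twist `W′ = W.quadraticTwist d` and `Ψ = QuadraticTwistSelmer.twistH1Equiv`
(Greenberg LNM 1716 §4 p. 107 «`A_s = A` as `G_{F_∞}`-modules»; T. Dokchitser 2013 §4: `E_d ≅ E` over `K(√d)` with the Galois action twisted by the quadratic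
character) — only the first layer of a tower over the base `K` carries such a datum (`√d ∈ K_{n+1}`, `d ∈ K` forces `√d ∈ K_1`); every layer `K_{n+1}/K_n` is the
first layer of the re-based tower `K_∞/K_n`, whose twisting element `d_n` lies in `K_n`.

THE POINT. With `r′ = res_{K_n→K_{n+1}}` on `H¹(·, W′[2^∞])`, `cor′` the corestriction, `σ = conj_g` on `X = H¹(K_{n+1}, W[2^∞])`, `S = Sel_{n+1}`, `M = S ∩ ker(σ + 1)`:
* `conj′_g` fixes `r′(H¹(K_n, W′[2^∞]))` (`g ∈ Gal(K̄/K_n)`), so `σ(Ψ r′c) = −Ψ(conj′_g r′c) = −Ψ(r′c)`: **`J := Ψ(r′(Sel(W′/K_n))) ≤ M`** (`map_twist_le_normKer`);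
* for `m ∈ M`, `y = Ψ⁻¹m ∈ Sel(W′/K_{n+1})`, `cor′y ∈ Sel(W′/K_n)` and `Ψ(r′ cor′ y) = Ψ(y + conj′_g y) = m − σm = 2m`: **`2·M ≤ J`** (`two_nsmul_mem_map_twist`);
* hence (§1) **`#J ∣ #M ∣ #J·#M[2]`**, `#Sel(W′/K_n) = #J·#(ker r′ ∩ Sel(W′/K_n))`, ★★ **`#Sel(W′/K_n) ∣ #M·#(ker r′ ∩ Sel(W′/K_n))`**, ★★ **`#M ∣ #Sel(W′/K_n)·#M[2]`**,
  and with `r′` injective (`W′(K)[2] = 0`) ★★★ **`#Sel_{2^∞}(W′/K_n) ∣ #M_{n+1} ∣ #Sel_{2^∞}(W′/K_n)·#M_{n+1}[2]`**; `M[2] = Sel⁺[2]` (`normKer_inf_torsionBy_eq`);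
* (§2, with the plus part of `…GrowthFiniteTwist` and gen 57) the ORDER FORM OF DOKCHITSER–DOKCHITSER'S LEMMA 4.14 with explicit `2`-torsion defects on the seed cell:
  ★★ **`#Sel(W/K_n)·#Sel(W′/K_n) ∣ #Sel(W/K_{n+1})·#M[2]`** and ★★ **`#Sel(W/K_{n+1}) ∣ #Sel(W/K_n)·#Sel(W′/K_n)·#Sel⁺[2]·#M[2]`**;
* (§3) the `μ`-reading: ★★ **`2^{2ⁿμ(X(W/K_∞))} ∣ #Sel_{2^∞}(W′/K_n)·#M_{n+1}[2]·#ker g_{n+1}`** on the seed cell (`μ` is bounded by the descent data of the TWIST one layer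
  DOWN), and ★★★ THE DOOR ON THE TWIST, NO HYPOTHESIS, ANY RANK: **`0 < #Sel_{2^∞}(W′/K_n)·#M_{n+1}[2]·#ker g_{n+1} < 2^{2ⁿ}` at ONE layer ⟹ `μ(X(W/K_∞)) = 0`**.
What is NOT claimed: nothing about any curve; no Selmer group computed; C2 untouched. Memo `Cruxes/MainConjectureOfRankZeroBSDAtTwo/TWIST-READING-att-p5-g58.md`.

References: T. Dokchitser, V. Dokchitser, Ann. of Math. 172 (2010), Lemma 4.14 (proof) [DokchitserDokchitserAnnals2010]; T. Dokchitser, *Notes on the parity conjecture*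
(2013) §4 [Dokchitser2013ParityNotes]; R. Greenberg, LNM 1716 (1999), §1 pp. 60–65, Conj. 1.11, §3 Lemmas 3.1–3.3, §4 p. 107 and Lemma 4.3 [GreenbergLNM1716];
J.-P. Serre, *Galois Cohomology*, I.§2.4–2.6 [SerreGaloisCohomology1997]; B. Mazur, Invent. Math. 18 (1972) §6 [Mazur1972]; L. Washington, GTM 83 §13.3 [Washington1997].
-/

set_option linter.dupNamespace false
set_option autoImplicit false

noncomputable section

open scoped Classical AddSubgroup Polynomial

universe u

namespace Summit.BirchSwinnertonDyer.BirchSwinnertonDyer.Theorems.AlignedTransportAtTwoHalfDescentLayerIndexGrowthFiniteTwistMinus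

open WeierstrassCurve Literature.NumberTheory.EllipticCurves Literature.NumberTheory.EllipticCurves.IwasawaDual
  Literature.NumberTheory.EllipticCurves.IwasawaAlgebra
  Summit.BirchSwinnertonDyer.Rank1Residual.X1.MuLambda
  Summit.BirchSwinnertonDyer.Rank1Residual.Iwasawa
  Summit.BirchSwinnertonDyer.BirchSwinnertonDyer.Theorems
  Summit.BirchSwinnertonDyer.BirchSwinnertonDyer.Theorems.AlignedTransportAtTwoHalfDescentLayerIndexGrowthFinite
  Summit.BirchSwinnertonDyer.BirchSwinnertonDyer.Theorems.AlignedTransportAtTwoHalfDescentLayerIndexGrowthFiniteTwo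
  Summit.BirchSwinnertonDyer.BirchSwinnertonDyer.Theorems.AlignedTransportAtTwoHalfDescentLayerIndexGrowthFiniteCell
  Summit.BirchSwinnertonDyer.BirchSwinnertonDyer.Theorems.AlignedTransportAtTwoHalfDescentLayerIndexGrowthFiniteTwist

variable {K : Type u} [Field K] [NumberField K] (W W' : WeierstrassCurve K) (κ : ZpExtension K 2) {γ : Field.absoluteGaloisGroup K} (n : ℕ)
  (Ψ : W'.subgroupH1 2 (κ.layerSubgroup (n + 1)) ≃+ W.subgroupH1 2 (κ.layerSubgroup (n + 1)))

/-! ## §1 The minus part `M_{n+1}` versus `Ψ(res Sel_{2^∞}(W′/K_n))`: `J ≤ M`, `2M ≤ J`, `#J ∣ #M ∣ #J·#M[2]` -/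

/-- ★★★ **`Ψ(res(Sel_{2^∞}(W′/K_n))) ≤ M_{n+1} := Sel_{2^∞}(W/K_{n+1}) ∩ ker(conj_{γ^{2ⁿ}} + 1)`** (the minus part / kernel of the relative norm `N_{K_{n+1}/K_n}`): restricted
classes are fixed by `conj′_g` (`g = γ^{2ⁿ} ∈ Gal(K̄/K_n)`), and `Ψ` turns `conj′_g`-fixed into `conj_g`-ANTI-fixed. [cite: GreenbergLNM1716, §4 p. 107]
[cite: Dokchitser2013ParityNotes, §4] [cite: DokchitserDokchitserAnnals2010, Lemma 4.14 (proof)] -/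
theorem map_twist_le_normKer (hγ : κ.IsTopGenerator γ)
    (hΨsel : ∀ x, x ∈ W'.selmerLayer κ (n + 1) ↔ Ψ x ∈ W.selmerLayer κ (n + 1))
    (hΨg : ∀ x, Ψ (W'.conjH1 2 (κ.layerSubgroup (n + 1)) (γ ^ 2 ^ n) x) = -(W.conjH1 2 (κ.layerSubgroup (n + 1)) (γ ^ 2 ^ n) (Ψ x))) :
    (W'.selmerLayer κ n).map ((Ψ : W'.subgroupH1 2 (κ.layerSubgroup (n + 1)) →+ W.subgroupH1 2 (κ.layerSubgroup (n + 1))).comp (W'.resOfLe 2 (κ.layerSubgroup_antitone (Nat.le_succ n)))) ≤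
      W.selmerLayer κ (n + 1) ⊓ (W.conjH1 2 (κ.layerSubgroup (n + 1)) (γ ^ 2 ^ n) + AddMonoidHom.id (W.subgroupH1 2 (κ.layerSubgroup (n + 1)))).ker := by
  rintro _ ⟨c, hc, rfl⟩
  rw [AddMonoidHom.comp_apply, AddMonoidHom.coe_coe]
  have hres : W'.resOfLe 2 (κ.layerSubgroup_antitone (Nat.le_succ n)) c ∈ W'.selmerLayer κ (n + 1) := W'.resOfLe_mem_selmerLayer κ (Nat.le_succ n) hc
  refine AddSubgroup.mem_inf.mpr ⟨(hΨsel _).mp hres, ?_⟩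
  rw [AddMonoidHom.mem_ker, AddMonoidHom.add_apply, AddMonoidHom.id_apply]
  have h := hΨg (W'.resOfLe 2 (κ.layerSubgroup_antitone (Nat.le_succ n)) c)
  rw [conjH1_resOfLe_layer_eq W' κ (κ.pow_mem_layerSubgroup hγ n) c] at h
  exact (add_comm _ _).trans (eq_neg_iff_add_eq_zero.mp h)

/-- ★★★ **`2·M_{n+1} ≤ Ψ(res(Sel_{2^∞}(W′/K_n)))`**: for `m ∈ M_{n+1}`, `y = Ψ⁻¹ m ∈ Sel_{2^∞}(W′/K_{n+1})`, `cor′ y ∈ Sel_{2^∞}(W′/K_n)` (tree `coresLayer_mem_selmerLayer`) and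
`Ψ(res cor′ y) = Ψ(y + conj′_g y) = m − conj_g m = 2m` (tree `TowerCorank.resOfLe_coresLayer_eq_sum`). [cite: SerreGaloisCohomology1997, I.§2.4 Prop. 9]
[cite: DokchitserDokchitserAnnals2010, Lemma 4.14 (proof)] -/
theorem two_nsmul_mem_map_twist (hγ : κ.IsTopGenerator γ)
    (hΨsel : ∀ x, x ∈ W'.selmerLayer κ (n + 1) ↔ Ψ x ∈ W.selmerLayer κ (n + 1))
    (hΨg : ∀ x, Ψ (W'.conjH1 2 (κ.layerSubgroup (n + 1)) (γ ^ 2 ^ n) x) = -(W.conjH1 2 (κ.layerSubgroup (n + 1)) (γ ^ 2 ^ n) (Ψ x)))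
    {m : W.subgroupH1 2 (κ.layerSubgroup (n + 1))}
    (hm : m ∈ W.selmerLayer κ (n + 1) ⊓ (W.conjH1 2 (κ.layerSubgroup (n + 1)) (γ ^ 2 ^ n) + AddMonoidHom.id (W.subgroupH1 2 (κ.layerSubgroup (n + 1)))).ker) :
    (2 : ℕ) • m ∈ (W'.selmerLayer κ n).map ((Ψ : W'.subgroupH1 2 (κ.layerSubgroup (n + 1)) →+ W.subgroupH1 2 (κ.layerSubgroup (n + 1))).comp (W'.resOfLe 2 (κ.layerSubgroup_antitone (Nat.le_succ n)))) := by
  obtain ⟨hmS, -⟩ := AddSubgroup.mem_inf.mp hm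
  have hσm := apply_eq_neg_of_mem_inf_ker _ _ hm
  have hy1 : Ψ.symm m ∈ W'.selmerLayer κ (n + 1) := (hΨsel _).mpr (by rw [AddEquiv.apply_symm_apply]; exact hmS)
  refine ⟨W'.coresLayer 2 κ n (Ψ.symm m), W'.coresLayer_mem_selmerLayer 2 κ n hy1, ?_⟩
  rw [AddMonoidHom.comp_apply, AddMonoidHom.coe_coe, TowerCorank.resOfLe_coresLayer_eq_sum W' 2 κ hγ n (Ψ.symm m),
    Finset.sum_range_succ, Finset.sum_range_succ, Finset.sum_range_zero, zero_add, pow_zero, pow_one, map_add]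
  have h1 : W'.conjH1 2 (κ.layerSubgroup (n + 1)) 1 = AddMonoidHom.id _ := W'.conjH1_one_holds 2 _
  rw [h1, AddMonoidHom.id_apply, hΨg, AddEquiv.apply_symm_apply, hσm, neg_neg, two_nsmul]

/-- `#Ψ(res Sel(W′/K_n)) ∣ #M_{n+1}`. [cite: DokchitserDokchitserAnnals2010, Lemma 4.14 (proof)] -/
theorem natCard_map_twist_dvd_natCard_normKer (hγ : κ.IsTopGenerator γ)
    (hΨsel : ∀ x, x ∈ W'.selmerLayer κ (n + 1) ↔ Ψ x ∈ W.selmerLayer κ (n + 1))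
    (hΨg : ∀ x, Ψ (W'.conjH1 2 (κ.layerSubgroup (n + 1)) (γ ^ 2 ^ n) x) = -(W.conjH1 2 (κ.layerSubgroup (n + 1)) (γ ^ 2 ^ n) (Ψ x))) :
    Nat.card ↥((W'.selmerLayer κ n).map ((Ψ : W'.subgroupH1 2 (κ.layerSubgroup (n + 1)) →+ W.subgroupH1 2 (κ.layerSubgroup (n + 1))).comp (W'.resOfLe 2 (κ.layerSubgroup_antitone (Nat.le_succ n))))) ∣
      Nat.card ↥(W.selmerLayer κ (n + 1) ⊓ (W.conjH1 2 (κ.layerSubgroup (n + 1)) (γ ^ 2 ^ n) + AddMonoidHom.id (W.subgroupH1 2 (κ.layerSubgroup (n + 1)))).ker) :=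
  AddSubgroup.card_dvd_of_le (map_twist_le_normKer W W' κ n Ψ hγ hΨsel hΨg)

/-- `#M_{n+1} ∣ #Ψ(res Sel(W′/K_n)) · #M_{n+1}[2]` (`2M ≤ J ≤ M`). [cite: DokchitserDokchitserAnnals2010, Lemma 4.14 (proof)] -/
theorem natCard_normKer_dvd_natCard_map_twist_mul (hγ : κ.IsTopGenerator γ)
    (hΨsel : ∀ x, x ∈ W'.selmerLayer κ (n + 1) ↔ Ψ x ∈ W.selmerLayer κ (n + 1))
    (hΨg : ∀ x, Ψ (W'.conjH1 2 (κ.layerSubgroup (n + 1)) (γ ^ 2 ^ n) x) = -(W.conjH1 2 (κ.layerSubgroup (n + 1)) (γ ^ 2 ^ n) (Ψ x))) :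
    Nat.card ↥(W.selmerLayer κ (n + 1) ⊓ (W.conjH1 2 (κ.layerSubgroup (n + 1)) (γ ^ 2 ^ n) + AddMonoidHom.id (W.subgroupH1 2 (κ.layerSubgroup (n + 1)))).ker) ∣
      Nat.card ↥((W'.selmerLayer κ n).map ((Ψ : W'.subgroupH1 2 (κ.layerSubgroup (n + 1)) →+ W.subgroupH1 2 (κ.layerSubgroup (n + 1))).comp (W'.resOfLe 2 (κ.layerSubgroup_antitone (Nat.le_succ n))))) *
        Nat.card ↥(W.selmerLayer κ (n + 1) ⊓ (W.conjH1 2 (κ.layerSubgroup (n + 1)) (γ ^ 2 ^ n) + AddMonoidHom.id (W.subgroupH1 2 (κ.layerSubgroup (n + 1)))).ker ⊓ AddSubgroup.torsionBy (W.subgroupH1 2 (κ.layerSubgroup (n + 1))) 2) :=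
  natCard_dvd_mul_natCard_inf_torsionBy_two _ _ fun _ hm ↦ two_nsmul_mem_map_twist W W' κ n Ψ hγ hΨsel hΨg hm

omit [NumberField K] in
/-- `#Sel(W′/K_n) = #Ψ(res Sel(W′/K_n)) · #(ker res′ ∩ Sel(W′/K_n))` (`Ψ` is injective). [folklore] -/
theorem natCard_selmerLayer_eq_natCard_map_twist_mul [NumberField K] :
    Nat.card (W'.selmerLayer κ n) =
      Nat.card ↥((W'.selmerLayer κ n).map ((Ψ : W'.subgroupH1 2 (κ.layerSubgroup (n + 1)) →+ W.subgroupH1 2 (κ.layerSubgroup (n + 1))).comp (W'.resOfLe 2 (κ.layerSubgroup_antitone (Nat.le_succ n))))) *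
        Nat.card ↥((W'.resOfLe 2 (κ.layerSubgroup_antitone (Nat.le_succ n))).ker ⊓ W'.selmerLayer κ n) := by
  rw [natCard_eq_natCard_map_mul_natCard_ker_inf ((Ψ : W'.subgroupH1 2 (κ.layerSubgroup (n + 1)) →+ W.subgroupH1 2 (κ.layerSubgroup (n + 1))).comp (W'.resOfLe 2 (κ.layerSubgroup_antitone (Nat.le_succ n)))) (W'.selmerLayer κ n),
    ker_coe_comp_eq]

/-- ★★ **`#Sel_{2^∞}(W′/K_n) ∣ #M_{n+1} · #(ker res′ ∩ Sel_{2^∞}(W′/K_n))`** — the twisted Selmer group one layer down injects into the minus part up to the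
restriction kernel (`≅ H¹(Gal(K_{n+1}/K_n), W′(K_{n+1})[2^∞])`, killed by `2`). No hypothesis beyond the twisting datum. [cite: DokchitserDokchitserAnnals2010, Lemma 4.14 (proof)]
[cite: GreenbergLNM1716, §3 Lemma 3.1, §4 p. 107] -/
theorem natCard_selmerLayer_twist_dvd (hγ : κ.IsTopGenerator γ)
    (hΨsel : ∀ x, x ∈ W'.selmerLayer κ (n + 1) ↔ Ψ x ∈ W.selmerLayer κ (n + 1))
    (hΨg : ∀ x, Ψ (W'.conjH1 2 (κ.layerSubgroup (n + 1)) (γ ^ 2 ^ n) x) = -(W.conjH1 2 (κ.layerSubgroup (n + 1)) (γ ^ 2 ^ n) (Ψ x))) :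
    Nat.card (W'.selmerLayer κ n) ∣
      Nat.card ↥(W.selmerLayer κ (n + 1) ⊓ (W.conjH1 2 (κ.layerSubgroup (n + 1)) (γ ^ 2 ^ n) + AddMonoidHom.id (W.subgroupH1 2 (κ.layerSubgroup (n + 1)))).ker) *
        Nat.card ↥((W'.resOfLe 2 (κ.layerSubgroup_antitone (Nat.le_succ n))).ker ⊓ W'.selmerLayer κ n) := by
  rw [natCard_selmerLayer_eq_natCard_map_twist_mul W W' κ n Ψ]
  exact mul_dvd_mul_right (natCard_map_twist_dvd_natCard_normKer W W' κ n Ψ hγ hΨsel hΨg) _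

/-- ★★ **`#M_{n+1} ∣ #Sel_{2^∞}(W′/K_n) · #M_{n+1}[2]`** — the minus part is at most the twisted Selmer group one layer down times its own `2`-torsion. No hypothesis
beyond the twisting datum. [cite: DokchitserDokchitserAnnals2010, Lemma 4.14 (proof)] [cite: GreenbergLNM1716, §4 p. 107] -/
theorem natCard_normKer_dvd_natCard_selmerLayer_twist_mul (hγ : κ.IsTopGenerator γ)
    (hΨsel : ∀ x, x ∈ W'.selmerLayer κ (n + 1) ↔ Ψ x ∈ W.selmerLayer κ (n + 1))
    (hΨg : ∀ x, Ψ (W'.conjH1 2 (κ.layerSubgroup (n + 1)) (γ ^ 2 ^ n) x) = -(W.conjH1 2 (κ.layerSubgroup (n + 1)) (γ ^ 2 ^ n) (Ψ x))) :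
    Nat.card ↥(W.selmerLayer κ (n + 1) ⊓ (W.conjH1 2 (κ.layerSubgroup (n + 1)) (γ ^ 2 ^ n) + AddMonoidHom.id (W.subgroupH1 2 (κ.layerSubgroup (n + 1)))).ker) ∣
      Nat.card (W'.selmerLayer κ n) *
        Nat.card ↥(W.selmerLayer κ (n + 1) ⊓ (W.conjH1 2 (κ.layerSubgroup (n + 1)) (γ ^ 2 ^ n) + AddMonoidHom.id (W.subgroupH1 2 (κ.layerSubgroup (n + 1)))).ker ⊓ AddSubgroup.torsionBy (W.subgroupH1 2 (κ.layerSubgroup (n + 1))) 2) := by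
  have hJ : Nat.card ↥((W'.selmerLayer κ n).map ((Ψ : W'.subgroupH1 2 (κ.layerSubgroup (n + 1)) →+ W.subgroupH1 2 (κ.layerSubgroup (n + 1))).comp (W'.resOfLe 2 (κ.layerSubgroup_antitone (Nat.le_succ n))))) ∣
      Nat.card (W'.selmerLayer κ n) :=
    Dvd.intro _ (natCard_selmerLayer_eq_natCard_map_twist_mul W W' κ n Ψ).symm
  exact (natCard_normKer_dvd_natCard_map_twist_mul W W' κ n Ψ hγ hΨsel hΨg).trans (mul_dvd_mul_right hJ _)

/-- ★★★ **`#Sel_{2^∞}(W′/K_n) ∣ #M_{n+1} ∣ #Sel_{2^∞}(W′/K_n) · #M_{n+1}[2]`** when `res′` is injective (e.g. `W′(K)[2] = 0`): THE MINUS PART OF `Sel_{2^∞}(E/K_{n+1})` UNDER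
`Gal(K_{n+1}/K_n)` — gen 57's signed object at finite level, which carries the growth number `g_n` — IS THE `2^∞`-SELMER GROUP OF THE TWIST ONE LAYER DOWN, up to its
`2`-torsion. [cite: DokchitserDokchitserAnnals2010, Lemma 4.14 (proof)] [cite: GreenbergLNM1716, §3 Lemma 3.1, §4 p. 107] [cite: Dokchitser2013ParityNotes, §4] -/
theorem natCard_selmerLayer_twist_dvd_and_dvd_of_injective (hγ : κ.IsTopGenerator γ)
    (hΨsel : ∀ x, x ∈ W'.selmerLayer κ (n + 1) ↔ Ψ x ∈ W.selmerLayer κ (n + 1))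
    (hΨg : ∀ x, Ψ (W'.conjH1 2 (κ.layerSubgroup (n + 1)) (γ ^ 2 ^ n) x) = -(W.conjH1 2 (κ.layerSubgroup (n + 1)) (γ ^ 2 ^ n) (Ψ x)))
    (hinj : Function.Injective (W'.resOfLe 2 (κ.layerSubgroup_antitone (Nat.le_succ n)))) :
    Nat.card (W'.selmerLayer κ n) ∣
        Nat.card ↥(W.selmerLayer κ (n + 1) ⊓ (W.conjH1 2 (κ.layerSubgroup (n + 1)) (γ ^ 2 ^ n) + AddMonoidHom.id (W.subgroupH1 2 (κ.layerSubgroup (n + 1)))).ker) ∧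
      Nat.card ↥(W.selmerLayer κ (n + 1) ⊓ (W.conjH1 2 (κ.layerSubgroup (n + 1)) (γ ^ 2 ^ n) + AddMonoidHom.id (W.subgroupH1 2 (κ.layerSubgroup (n + 1)))).ker) ∣
        Nat.card (W'.selmerLayer κ n) *
          Nat.card ↥(W.selmerLayer κ (n + 1) ⊓ (W.conjH1 2 (κ.layerSubgroup (n + 1)) (γ ^ 2 ^ n) + AddMonoidHom.id (W.subgroupH1 2 (κ.layerSubgroup (n + 1)))).ker ⊓ AddSubgroup.torsionBy (W.subgroupH1 2 (κ.layerSubgroup (n + 1))) 2) := by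
  refine ⟨?_, natCard_normKer_dvd_natCard_selmerLayer_twist_mul W W' κ n Ψ hγ hΨsel hΨg⟩
  have h := natCard_selmerLayer_twist_dvd W W' κ n Ψ hγ hΨsel hΨg
  rw [(AddMonoidHom.ker_eq_bot_iff _).mpr hinj, bot_inf_eq, AddSubgroup.card_bot, mul_one] at h
  exact h

/-- The same under `W′(K)[2] = 0` (tree `resOfLe_layer_injective`: `res′` is injective along any `ℤ₂`-extension). [cite: GreenbergLNM1716, §3 Lemma 3.1] -/
theorem natCard_selmerLayer_twist_dvd_and_dvd_of_noTorsion [W'.IsElliptic] (hK' : ∀ P : W'.toAffine.Point, 2 • P = 0 → P = 0) (hγ : κ.IsTopGenerator γ)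
    (hΨsel : ∀ x, x ∈ W'.selmerLayer κ (n + 1) ↔ Ψ x ∈ W.selmerLayer κ (n + 1))
    (hΨg : ∀ x, Ψ (W'.conjH1 2 (κ.layerSubgroup (n + 1)) (γ ^ 2 ^ n) x) = -(W.conjH1 2 (κ.layerSubgroup (n + 1)) (γ ^ 2 ^ n) (Ψ x))) :
    Nat.card (W'.selmerLayer κ n) ∣
        Nat.card ↥(W.selmerLayer κ (n + 1) ⊓ (W.conjH1 2 (κ.layerSubgroup (n + 1)) (γ ^ 2 ^ n) + AddMonoidHom.id (W.subgroupH1 2 (κ.layerSubgroup (n + 1)))).ker) ∧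
      Nat.card ↥(W.selmerLayer κ (n + 1) ⊓ (W.conjH1 2 (κ.layerSubgroup (n + 1)) (γ ^ 2 ^ n) + AddMonoidHom.id (W.subgroupH1 2 (κ.layerSubgroup (n + 1)))).ker) ∣
        Nat.card (W'.selmerLayer κ n) *
          Nat.card ↥(W.selmerLayer κ (n + 1) ⊓ (W.conjH1 2 (κ.layerSubgroup (n + 1)) (γ ^ 2 ^ n) + AddMonoidHom.id (W.subgroupH1 2 (κ.layerSubgroup (n + 1)))).ker ⊓ AddSubgroup.torsionBy (W.subgroupH1 2 (κ.layerSubgroup (n + 1))) 2) :=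
  natCard_selmerLayer_twist_dvd_and_dvd_of_injective W W' κ n Ψ hγ hΨsel hΨg (W'.resOfLe_layer_injective κ hK' (Nat.le_succ n))

omit [NumberField K] in
/-- **`M_{n+1}[2] = Sel⁺_{n+1}[2]`**: the `2`-torsion of the minus part is the `2`-torsion of the plus part (`σc = −c ⟺ σc = c` when `2c = 0`) — it lies in the part of
`Sel_{2^∞}(E/K_{n+1})[2]` fixed by `Gal(K_{n+1}/K_n)`. [folklore] -/
theorem normKer_inf_torsionBy_eq [NumberField K] :
    W.selmerLayer κ (n + 1) ⊓ (W.conjH1 2 (κ.layerSubgroup (n + 1)) (γ ^ 2 ^ n) + AddMonoidHom.id (W.subgroupH1 2 (κ.layerSubgroup (n + 1)))).ker ⊓ AddSubgroup.torsionBy (W.subgroupH1 2 (κ.layerSubgroup (n + 1))) 2 =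
      W.selmerLayer κ (n + 1) ⊓ (W.conjH1 2 (κ.layerSubgroup (n + 1)) (γ ^ 2 ^ n) - AddMonoidHom.id (W.subgroupH1 2 (κ.layerSubgroup (n + 1)))).ker ⊓ AddSubgroup.torsionBy (W.subgroupH1 2 (κ.layerSubgroup (n + 1))) 2 :=
  inf_ker_add_inf_torsionBy_eq _ _

/-! ## §2 The order form of `Sel(E/K_{n+1}) ≈ Sel(E/K_n) ⊕ Sel(E′/K_n)` with explicit `2`-torsion defects (seed cell) -/

/-- ★★ **`#Sel_{2^∞}(W/K_n) · #Sel_{2^∞}(W′/K_n) ∣ #Sel_{2^∞}(W/K_{n+1}) · #M_{n+1}[2]`** on the seed cell (`W(K)[2] = 0`, `res′` injective): `#Sel_{n+1} = #Sel⁺·#I` (file I),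
`#Sel_n ∣ #Sel⁺` (file I, cell), `#Sel(W′/K_n) ∣ #M ∣ #I·#M[2]` (§1 and gen 57). [cite: DokchitserDokchitserAnnals2010, Lemma 4.14 (proof)] [cite: GreenbergLNM1716, §3 Lemmas 3.1–3.3] -/
theorem natCard_selmerLayer_mul_twist_dvd [W.IsElliptic] (hK : ∀ P : W.toAffine.Point, 2 • P = 0 → P = 0) (hγ : κ.IsTopGenerator γ)
    (hΨsel : ∀ x, x ∈ W'.selmerLayer κ (n + 1) ↔ Ψ x ∈ W.selmerLayer κ (n + 1))
    (hΨg : ∀ x, Ψ (W'.conjH1 2 (κ.layerSubgroup (n + 1)) (γ ^ 2 ^ n) x) = -(W.conjH1 2 (κ.layerSubgroup (n + 1)) (γ ^ 2 ^ n) (Ψ x)))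
    (hinj : Function.Injective (W'.resOfLe 2 (κ.layerSubgroup_antitone (Nat.le_succ n)))) :
    Nat.card (W.selmerLayer κ n) * Nat.card (W'.selmerLayer κ n) ∣
      Nat.card (W.selmerLayer κ (n + 1)) *
        Nat.card ↥(W.selmerLayer κ (n + 1) ⊓ (W.conjH1 2 (κ.layerSubgroup (n + 1)) (γ ^ 2 ^ n) + AddMonoidHom.id (W.subgroupH1 2 (κ.layerSubgroup (n + 1)))).ker ⊓ AddSubgroup.torsionBy (W.subgroupH1 2 (κ.layerSubgroup (n + 1))) 2) := by
  rw [natCard_selmerLayer_succ_eq_mul W κ (γ := γ) n]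
  have hplus : Nat.card (W.selmerLayer κ n) ∣
      Nat.card ↥(W.selmerLayer κ (n + 1) ⊓ (W.conjH1 2 (κ.layerSubgroup (n + 1)) (γ ^ 2 ^ n) - AddMonoidHom.id (W.subgroupH1 2 (κ.layerSubgroup (n + 1)))).ker) := by
    have h := natCard_map_resOfLe_selmerLayer_dvd W κ hγ n
    have he := natCard_selmerLayer_eq_mul W κ n
    rw [natCard_ker_resOfLe_inf_selmerLayer_eq_one W κ hK n, mul_one] at he
    rw [← he] at h
    exact h
  have hminus : Nat.card (W'.selmerLayer κ n) ∣
      Nat.card ↥((W.selmerLayer κ (n + 1)).map (W.conjH1 2 (κ.layerSubgroup (n + 1)) (γ ^ 2 ^ n) - AddMonoidHom.id (W.subgroupH1 2 (κ.layerSubgroup (n + 1))))) *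
        Nat.card ↥(W.selmerLayer κ (n + 1) ⊓ (W.conjH1 2 (κ.layerSubgroup (n + 1)) (γ ^ 2 ^ n) + AddMonoidHom.id (W.subgroupH1 2 (κ.layerSubgroup (n + 1)))).ker ⊓ AddSubgroup.torsionBy (W.subgroupH1 2 (κ.layerSubgroup (n + 1))) 2) :=
    (natCard_selmerLayer_twist_dvd_and_dvd_of_injective W W' κ n Ψ hγ hΨsel hΨg hinj).1.trans (natCard_normKer_dvd_mul W κ n)
  calc Nat.card (W.selmerLayer κ n) * Nat.card (W'.selmerLayer κ n)
      ∣ Nat.card ↥(W.selmerLayer κ (n + 1) ⊓ (W.conjH1 2 (κ.layerSubgroup (n + 1)) (γ ^ 2 ^ n) - AddMonoidHom.id (W.subgroupH1 2 (κ.layerSubgroup (n + 1)))).ker) *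
          (Nat.card ↥((W.selmerLayer κ (n + 1)).map (W.conjH1 2 (κ.layerSubgroup (n + 1)) (γ ^ 2 ^ n) - AddMonoidHom.id (W.subgroupH1 2 (κ.layerSubgroup (n + 1))))) *
            Nat.card ↥(W.selmerLayer κ (n + 1) ⊓ (W.conjH1 2 (κ.layerSubgroup (n + 1)) (γ ^ 2 ^ n) + AddMonoidHom.id (W.subgroupH1 2 (κ.layerSubgroup (n + 1)))).ker ⊓ AddSubgroup.torsionBy (W.subgroupH1 2 (κ.layerSubgroup (n + 1))) 2)) := mul_dvd_mul hplus hminus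
    _ = _ := by ring

/-- ★★ **`#Sel_{2^∞}(W/K_{n+1}) ∣ #Sel_{2^∞}(W/K_n) · #Sel_{2^∞}(W′/K_n) · #Sel⁺_{n+1}[2] · #M_{n+1}[2]`** for EVERY number field, `ℤ₂`-extension, layer and twisting datum — no
hypothesis (`#Sel_{n+1} = #Sel⁺·#I`, `#Sel⁺ ∣ #Sel_n·#Sel⁺[2]`, `#I ∣ #M ∣ #Sel(W′/K_n)·#M[2]`). [cite: DokchitserDokchitserAnnals2010, Lemma 4.14 (proof)]
[cite: GreenbergLNM1716, §3 Lemmas 3.1–3.3] -/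
theorem natCard_selmerLayer_succ_dvd_mul_twist (hγ : κ.IsTopGenerator γ)
    (hΨsel : ∀ x, x ∈ W'.selmerLayer κ (n + 1) ↔ Ψ x ∈ W.selmerLayer κ (n + 1))
    (hΨg : ∀ x, Ψ (W'.conjH1 2 (κ.layerSubgroup (n + 1)) (γ ^ 2 ^ n) x) = -(W.conjH1 2 (κ.layerSubgroup (n + 1)) (γ ^ 2 ^ n) (Ψ x))) :
    Nat.card (W.selmerLayer κ (n + 1)) ∣
      Nat.card (W.selmerLayer κ n) * Nat.card (W'.selmerLayer κ n) *
          Nat.card ↥(W.selmerLayer κ (n + 1) ⊓ (W.conjH1 2 (κ.layerSubgroup (n + 1)) (γ ^ 2 ^ n) - AddMonoidHom.id (W.subgroupH1 2 (κ.layerSubgroup (n + 1)))).ker ⊓ AddSubgroup.torsionBy (W.subgroupH1 2 (κ.layerSubgroup (n + 1))) 2) *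
        Nat.card ↥(W.selmerLayer κ (n + 1) ⊓ (W.conjH1 2 (κ.layerSubgroup (n + 1)) (γ ^ 2 ^ n) + AddMonoidHom.id (W.subgroupH1 2 (κ.layerSubgroup (n + 1)))).ker ⊓ AddSubgroup.torsionBy (W.subgroupH1 2 (κ.layerSubgroup (n + 1))) 2) := by
  rw [natCard_selmerLayer_succ_eq_mul W κ (γ := γ) n]
  have hplus : Nat.card ↥(W.selmerLayer κ (n + 1) ⊓ (W.conjH1 2 (κ.layerSubgroup (n + 1)) (γ ^ 2 ^ n) - AddMonoidHom.id (W.subgroupH1 2 (κ.layerSubgroup (n + 1)))).ker) ∣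
      Nat.card (W.selmerLayer κ n) *
        Nat.card ↥(W.selmerLayer κ (n + 1) ⊓ (W.conjH1 2 (κ.layerSubgroup (n + 1)) (γ ^ 2 ^ n) - AddMonoidHom.id (W.subgroupH1 2 (κ.layerSubgroup (n + 1)))).ker ⊓ AddSubgroup.torsionBy (W.subgroupH1 2 (κ.layerSubgroup (n + 1))) 2) := by
    have h1 : Nat.card ↥(W.selmerLayer κ (n + 1) ⊓ (W.conjH1 2 (κ.layerSubgroup (n + 1)) (γ ^ 2 ^ n) - AddMonoidHom.id (W.subgroupH1 2 (κ.layerSubgroup (n + 1)))).ker) ∣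
        Nat.card ↥((W.selmerLayer κ n).map (W.resOfLe 2 (κ.layerSubgroup_antitone (Nat.le_succ n)))) *
          Nat.card ↥(W.selmerLayer κ (n + 1) ⊓ (W.conjH1 2 (κ.layerSubgroup (n + 1)) (γ ^ 2 ^ n) - AddMonoidHom.id (W.subgroupH1 2 (κ.layerSubgroup (n + 1)))).ker ⊓ AddSubgroup.torsionBy (W.subgroupH1 2 (κ.layerSubgroup (n + 1))) 2) :=
      natCard_inf_ker_sub_dvd_mul W κ hγ n
    have h2 : Nat.card ↥((W.selmerLayer κ n).map (W.resOfLe 2 (κ.layerSubgroup_antitone (Nat.le_succ n)))) ∣ Nat.card (W.selmerLayer κ n) :=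
      Dvd.intro _ (natCard_selmerLayer_eq_mul W κ n).symm
    exact h1.trans (mul_dvd_mul_right h2 _)
  have hminus : Nat.card ↥((W.selmerLayer κ (n + 1)).map (W.conjH1 2 (κ.layerSubgroup (n + 1)) (γ ^ 2 ^ n) - AddMonoidHom.id (W.subgroupH1 2 (κ.layerSubgroup (n + 1))))) ∣
      Nat.card (W'.selmerLayer κ n) *
        Nat.card ↥(W.selmerLayer κ (n + 1) ⊓ (W.conjH1 2 (κ.layerSubgroup (n + 1)) (γ ^ 2 ^ n) + AddMonoidHom.id (W.subgroupH1 2 (κ.layerSubgroup (n + 1)))).ker ⊓ AddSubgroup.torsionBy (W.subgroupH1 2 (κ.layerSubgroup (n + 1))) 2) :=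
    (natCard_map_dvd_natCard_normKer W κ hγ n).trans (natCard_normKer_dvd_natCard_selmerLayer_twist_mul W W' κ n Ψ hγ hΨsel hΨg)
  calc Nat.card ↥(W.selmerLayer κ (n + 1) ⊓ (W.conjH1 2 (κ.layerSubgroup (n + 1)) (γ ^ 2 ^ n) - AddMonoidHom.id (W.subgroupH1 2 (κ.layerSubgroup (n + 1)))).ker) *
        Nat.card ↥((W.selmerLayer κ (n + 1)).map (W.conjH1 2 (κ.layerSubgroup (n + 1)) (γ ^ 2 ^ n) - AddMonoidHom.id (W.subgroupH1 2 (κ.layerSubgroup (n + 1)))))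
      ∣ Nat.card (W.selmerLayer κ n) *
            Nat.card ↥(W.selmerLayer κ (n + 1) ⊓ (W.conjH1 2 (κ.layerSubgroup (n + 1)) (γ ^ 2 ^ n) - AddMonoidHom.id (W.subgroupH1 2 (κ.layerSubgroup (n + 1)))).ker ⊓ AddSubgroup.torsionBy (W.subgroupH1 2 (κ.layerSubgroup (n + 1))) 2) *
          (Nat.card (W'.selmerLayer κ n) *
            Nat.card ↥(W.selmerLayer κ (n + 1) ⊓ (W.conjH1 2 (κ.layerSubgroup (n + 1)) (γ ^ 2 ^ n) + AddMonoidHom.id (W.subgroupH1 2 (κ.layerSubgroup (n + 1)))).ker ⊓ AddSubgroup.torsionBy (W.subgroupH1 2 (κ.layerSubgroup (n + 1))) 2)) := mul_dvd_mul hplus hminus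
    _ = _ := by ring

/-! ## §3 The `μ`-reading and the door on the twist -/

/-- ★★ **`2^{2ⁿ·μ(X(W/K_∞))} ∣ #Sel_{2^∞}(W′/K_n) · #M_{n+1}[2] · #ker g_{n+1}`** on the seed cell (`W(K)[2] = 0`; `X` finitely generated torsion): `μ` is bounded by the descent data
of the TWIST ONE LAYER DOWN, the `2`-torsion of the minus part and Greenberg's control kernel (gen 57's `2^{2ⁿμ} ∣ #I_{n+1}·#ker g_{n+1}` and `#I ∣ #M ∣ #Sel(W′/K_n)·#M[2]`).
[cite: GreenbergLNM1716, Conj. 1.11, §3 Lemmas 3.1–3.3, §4 Lemma 4.3] [cite: Washington1997, §13.3 Thm. 13.13] [cite: DokchitserDokchitserAnnals2010, Lemma 4.14 (proof)] -/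
theorem pow_mu_dvd_natCard_selmerLayer_twist_mul [W.IsElliptic] (hK : ∀ P : W.toAffine.Point, 2 • P = 0 → P = 0) (hγ : κ.IsTopGenerator γ)
    (hΨsel : ∀ x, x ∈ W'.selmerLayer κ (n + 1) ↔ Ψ x ∈ W.selmerLayer κ (n + 1))
    (hΨg : ∀ x, Ψ (W'.conjH1 2 (κ.layerSubgroup (n + 1)) (γ ^ 2 ^ n) x) = -(W.conjH1 2 (κ.layerSubgroup (n + 1)) (γ ^ 2 ^ n) (Ψ x)))
    (D : W.SelmerDualData κ γ) [Module.Finite (IwasawaAlgebra 2) D.X] (hD : D.IsTorsion) :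
    2 ^ (2 ^ n * D.mu) ∣
      Nat.card (W'.selmerLayer κ n) *
          Nat.card ↥(W.selmerLayer κ (n + 1) ⊓ (W.conjH1 2 (κ.layerSubgroup (n + 1)) (γ ^ 2 ^ n) + AddMonoidHom.id (W.subgroupH1 2 (κ.layerSubgroup (n + 1)))).ker ⊓ AddSubgroup.torsionBy (W.subgroupH1 2 (κ.layerSubgroup (n + 1))) 2) *
        Nat.card (W.KerG κ (n + 1)) := by
  have h := pow_dvd_natCard_map_selmerLayer_mul_kerG W κ hK hγ D hD n
  rw [show (2 : ℕ) - 1 = 1 from rfl, mul_one] at h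
  have hI : Nat.card ↥((W.selmerLayer κ (n + 1)).map (W.conjH1 2 (κ.layerSubgroup (n + 1)) (γ ^ 2 ^ n) - AddMonoidHom.id (W.subgroupH1 2 (κ.layerSubgroup (n + 1))))) ∣
      Nat.card (W'.selmerLayer κ n) *
        Nat.card ↥(W.selmerLayer κ (n + 1) ⊓ (W.conjH1 2 (κ.layerSubgroup (n + 1)) (γ ^ 2 ^ n) + AddMonoidHom.id (W.subgroupH1 2 (κ.layerSubgroup (n + 1)))).ker ⊓ AddSubgroup.torsionBy (W.subgroupH1 2 (κ.layerSubgroup (n + 1))) 2) :=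
    (natCard_map_dvd_natCard_normKer W κ hγ n).trans (natCard_normKer_dvd_natCard_selmerLayer_twist_mul W W' κ n Ψ hγ hΨsel hΨg)
  exact h.trans (mul_dvd_mul_right hI _)

/-- ★★★ THE DOOR ON THE TWIST, ANY RANK, NO HYPOTHESIS beyond the twisting datum: **`0 < #Sel_{2^∞}(W′/K_n) · #M_{n+1}[2] · #ker g_{n+1} < 2^{2ⁿ}` at SOME layer ⟹
`μ(X(W/K_∞)) = 0`** (`X` finitely generated torsion) — gen 57's norm-kernel door `0 < #M_{n+1}·#ker g_{n+1} < 2^{2ⁿ}` fed by `#M ∣ #Sel(W′/K_n)·#M[2]`: the `2^∞`-Selmer group of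
ONE quadratic twist over the SMALLER field `K_n` (with the `2`-torsion of the minus part and the control kernel) certifies `μ = 0`. [cite: GreenbergLNM1716, Conj. 1.11, §3 Lemmas 3.1–3.3,
§4 Lemma 4.3 and p. 107] [cite: Mazur1972, §6] [cite: Washington1997, §13.3 Thm. 13.13] -/
theorem mu_eq_zero_of_natCard_selmerLayer_twist_mul_lt (hγ : κ.IsTopGenerator γ)
    (hΨsel : ∀ x, x ∈ W'.selmerLayer κ (n + 1) ↔ Ψ x ∈ W.selmerLayer κ (n + 1))
    (hΨg : ∀ x, Ψ (W'.conjH1 2 (κ.layerSubgroup (n + 1)) (γ ^ 2 ^ n) x) = -(W.conjH1 2 (κ.layerSubgroup (n + 1)) (γ ^ 2 ^ n) (Ψ x)))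
    (D : W.SelmerDualData κ γ) [Module.Finite (IwasawaAlgebra 2) D.X] (hD : D.IsTorsion)
    (hpos : 0 < Nat.card (W'.selmerLayer κ n) *
        Nat.card ↥(W.selmerLayer κ (n + 1) ⊓ (W.conjH1 2 (κ.layerSubgroup (n + 1)) (γ ^ 2 ^ n) + AddMonoidHom.id (W.subgroupH1 2 (κ.layerSubgroup (n + 1)))).ker ⊓ AddSubgroup.torsionBy (W.subgroupH1 2 (κ.layerSubgroup (n + 1))) 2) *
      Nat.card (W.KerG κ (n + 1)))
    (hlt : Nat.card (W'.selmerLayer κ n) *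
          Nat.card ↥(W.selmerLayer κ (n + 1) ⊓ (W.conjH1 2 (κ.layerSubgroup (n + 1)) (γ ^ 2 ^ n) + AddMonoidHom.id (W.subgroupH1 2 (κ.layerSubgroup (n + 1)))).ker ⊓ AddSubgroup.torsionBy (W.subgroupH1 2 (κ.layerSubgroup (n + 1))) 2) *
        Nat.card (W.KerG κ (n + 1)) < 2 ^ 2 ^ n) :
    D.mu = 0 := by
  obtain ⟨hSMpos, hGpos⟩ := CanonicallyOrderedAdd.mul_pos.mp hpos
  have hdvd := natCard_normKer_dvd_natCard_selmerLayer_twist_mul W W' κ n Ψ hγ hΨsel hΨg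
  have hMpos := Nat.pos_of_dvd_of_pos hdvd hSMpos
  have hMle := Nat.le_of_dvd hSMpos hdvd
  exact mu_eq_zero_of_natCard_normKer_mul_kerG_lt W κ hγ D hD (Nat.mul_pos hMpos hGpos) ((Nat.mul_le_mul_right _ hMle).trans_lt hlt)

end Summit.BirchSwinnertonDyer.BirchSwinnertonDyer.Theorems.AlignedTransportAtTwoHalfDescentLayerIndexGrowthFiniteTwistMinus

end
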